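import Literature.NumberTheory.EllipticCurves.Kobayashi2003.SignedSelmer
import Summits.BirchSwinnertonDyer.Rank1Residual.Additive.LocalModelTransportTower
import Summits.BirchSwinnertonDyer.Rank1Residual.Additive.StrictSignedSelmer
import HarnessLib

/-!
# Route `QuadraticBranchSignedControl` (rung K8, cell `bsd-potss`), crux `EtaTransportSigned`
# (item stmt-BirchSwinnertonDyer-19115), frame (i-f)₂ (change of the local model `E₁ → E₂` at `p`),
# brick 1: Kobayashi's local LAYER SUBGROUPS and LAYER POINTS `E(K_n·E)` correspond along a
# `K`-algebra map of models `E₁ → E₂` (x1b's LocalModelTransport pattern, files 101–103)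

WHAT. The remaining comparison frame (i-f)₂ of `…EtaTransportDecompositionOfFrames.lean` is the
equality `strictSignedSelmerInfty V κ ℚ_{v₀} 1 = strictSignedSelmerInfty V κ ℚ_[p] 1` — the plus
Selmer group of p17/Kobayashi does not depend on the MODEL of the completion at `p`
(`v₀.adicCompletion ℚ` vs Mathlib's `ℚ_[p]`, isomorphic `ℚ`-algebras by `padicEquiv`). Its proof is
a transport of Kobayashi's local objects (Def. 1.1: layer subgroups `Gal(Ē/K_n·E)`, layer points
`E(K_n·E)`, traces, signed points, Kummer condition) along x1b's model-transport data for a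
`K`-algebra map `E₁ → E₂` of models (`j = absClosureEmbedding E₁ E₂ : Ē₁ → Ē₂`,
`r = absGaloisRestrict E₁ E₂ : Γ_{E₂} → Γ_{E₁}`, the comparison element `τ ∈ Γ_K` with
`ι_{E₂} ∘ τ = j ∘ ι_{E₁}`, `LocalModelTransportH1`). THIS FILE = brick 1 of that transport, for
ANY `K`, `κ`, `W`, `E₁ → E₂`:
* `mem_localLayerSubgroupOfEmb_iff_absGaloisRestrict_mem` — `σ ∈ Gal(Ē₂/K_n·E₂) ↔ r σ ∈ Gal(Ē₁/K_n·E₁)`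
  (`res_{E₁}(r σ) = τ⁻¹ res_{E₂}(σ) τ` and `κ` is abelian-valued);
* `map_mem_localLayerPointsOfEmb_iff` — for `E₂/E₁` algebraic with `E₁ → E₂` onto (the two models
  isomorphic): `J Q ∈ E(K_n·E₂) ↔ Q ∈ E(K_n·E₁)`, `J = Point.map j` (`J(r σ • Q) = σ • J Q`, `r` onto,
  `J` injective).
* `map_localTraceOfEmb_eq` — `Tr^{E₂}_{n/m}(J Q) = J(Tr^{E₁}_{n/m} Q)` on layer points (`r` induces
  a bijection of the coset spaces; the trace is the sum over any system of representatives);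
* `map_mem_signedLocalPointsOfEmb_iff` — Kobayashi's signed groups `E^ε(K_n·E)` correspond.
Brick 2 (the Kummer condition `localKummerOverOfEmb`, which moves by `conj_τ` and is absorbed by the
`⨅` over conjugates in `strictSignedSelmerLayer`; then the equality of the Selmer groups) remains.

HONEST FRAMING (cell `bsd-potss`, run/shared/lean/pub/bsd-potss/; FULL-BSD rank ≤ 1 programme):
TOOL THEOREMS ONLY — no definition, no named Literature fact, no `sorry`, axioms standard;
UNCONDITIONAL. Nothing about (C1_η), Kobayashi's theorems or `BSD(W, p)` is claimed; no label or
count moves. Seat `bsd-potss-k8q-c3` (prover), g0.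

References: [Kobayashi2003] Def. 1.1 (p. 2) (`E(F_{n,p})`, `F_{n,p}` the completion at the place
over `p`); [SerreGaloisCohomology1997] II.§1.1 (restriction along embeddings of separable closures);
[MilneFT2022] Ch. 6–7.
-/

set_option autoImplicit false
set_option linter.dupNamespace false

noncomputable section

open scoped Classical

open Field WeierstrassCurve
open Literature.NumberTheory.EllipticCurves
open Literature.NumberTheory.GaloisRepresentations
open Summit.BirchSwinnertonDyer.Rank1Residual.Additive

universe u

namespace Summit.BirchSwinnertonDyer.BirchSwinnertonDyer.Theorems

variable {K : Type u} [Field K] (W : WeierstrassCurve K) {p : ℕ} [Fact p.Prime]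
  (κ : ZpExtension K p) (E₁ E₂ : Type u) [Field E₁] [Field E₂] [Algebra K E₁] [Algebra K E₂]
  [Algebra E₁ E₂]

/-- **The local layer subgroups correspond along `r : Γ_{E₂} → Γ_{E₁}`**:
`σ ∈ Gal(Ē₂/K_n·E₂) ↔ r σ ∈ Gal(Ē₁/K_n·E₁)` — `res_{E₁}(r σ) = τ⁻¹·res_{E₂}(σ)·τ`
(`absGaloisRestrict_absGaloisRestrict_eq_conj`) and `κ(τ⁻¹ g τ) = κ(g)`.
[cite: Kobayashi2003, Def. 1.1 (p. 2)] [cite: SerreGaloisCohomology1997, II.§1.1] -/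
theorem mem_localLayerSubgroupOfEmb_iff_absGaloisRestrict_mem [IsScalarTower K E₁ E₂] {τ : absoluteGaloisGroup K}
    (hτ : ∀ x : AlgebraicClosure K,
      absClosureEmbedding K E₂ (τ • x) = absClosureEmbedding E₁ E₂ (absClosureEmbedding K E₁ x))
    (n : ℕ) (σ : absoluteGaloisGroup E₂) :
    σ ∈ Kobayashi2003.localLayerSubgroupOfEmb κ (closureEmb (K := K) E₂) n ↔
      absGaloisRestrict E₁ E₂ σ ∈ Kobayashi2003.localLayerSubgroupOfEmb κ (closureEmb (K := K) E₁) n := by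
  rw [Kobayashi2003.mem_localLayerSubgroupOfEmb_iff, Kobayashi2003.mem_localLayerSubgroupOfEmb_iff,
    ← resGal_eq, ← resGal_eq]
  change (p : ℤ_[p]) ^ n ∣ (κ (absGaloisRestrict K E₂ σ)).toAdd ↔
    (p : ℤ_[p]) ^ n ∣ (κ (absGaloisRestrict K E₁ (absGaloisRestrict E₁ E₂ σ))).toAdd
  have hκ : κ (absGaloisRestrict K E₁ (absGaloisRestrict E₁ E₂ σ)) = κ (absGaloisRestrict K E₂ σ) := by
    rw [LocalModelTransport.absGaloisRestrict_absGaloisRestrict_eq_conj K E₁ E₂ hτ σ, map_mul, map_mul,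
      map_inv, mul_right_comm, inv_mul_cancel, one_mul]
  rw [hκ]

/-- `r` maps `Gal(Ē₂/K_n·E₂)` ONTO `Gal(Ē₁/K_n·E₁)` when the models are isomorphic (`E₁ → E₂` onto,
`E₂/E₁` algebraic: `r` is onto, `absGaloisRestrict_surjective_of_surjective`).
[cite: Kobayashi2003, Def. 1.1 (p. 2)] [cite: MilneFT2022, Ch. 7] -/
theorem exists_absGaloisRestrict_eq_of_mem_localLayerSubgroupOfEmb [IsScalarTower K E₁ E₂]
    [Algebra.IsAlgebraic E₁ E₂]
    (hs : Function.Surjective (algebraMap E₁ E₂)) {τ : absoluteGaloisGroup K}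
    (hτ : ∀ x : AlgebraicClosure K,
      absClosureEmbedding K E₂ (τ • x) = absClosureEmbedding E₁ E₂ (absClosureEmbedding K E₁ x))
    (n : ℕ) {σ₁ : absoluteGaloisGroup E₁}
    (hσ₁ : σ₁ ∈ Kobayashi2003.localLayerSubgroupOfEmb κ (closureEmb (K := K) E₁) n) :
    ∃ σ₂ ∈ Kobayashi2003.localLayerSubgroupOfEmb κ (closureEmb (K := K) E₂) n,
      absGaloisRestrict E₁ E₂ σ₂ = σ₁ := by
  obtain ⟨σ₂, rfl⟩ := LocalModelTransport.absGaloisRestrict_surjective_of_surjective E₁ E₂ hs σ₁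
  exact ⟨σ₂, (mem_localLayerSubgroupOfEmb_iff_absGaloisRestrict_mem κ E₁ E₂ hτ n σ₂).mpr hσ₁, rfl⟩

/-- **The layer points correspond: `J Q ∈ E(K_n·E₂) ↔ Q ∈ E(K_n·E₁)`** for isomorphic models,
`J = Point.map j` (`J(r σ • Q) = σ • J Q`, `map_smul_localPoints`; `r` onto; `J` injective).
[cite: Kobayashi2003, Def. 1.1 (p. 2)] [cite: SerreGaloisCohomology1997, II.§1.1] -/
theorem map_mem_localLayerPointsOfEmb_iff [IsScalarTower K E₁ E₂] [Algebra.IsAlgebraic E₁ E₂]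
    (hs : Function.Surjective (algebraMap E₁ E₂)) {τ : absoluteGaloisGroup K}
    (hτ : ∀ x : AlgebraicClosure K,
      absClosureEmbedding K E₂ (τ • x) = absClosureEmbedding E₁ E₂ (absClosureEmbedding K E₁ x))
    (n : ℕ) (Q : localPoints W E₁) :
    (show localPoints W E₁ →+ localPoints W E₂ from
        Affine.Point.map (W' := W) ((absClosureEmbedding E₁ E₂).restrictScalars K)) Q ∈
        Kobayashi2003.localLayerPointsOfEmb κ (closureEmb (K := K) E₂) W n ↔
      Q ∈ Kobayashi2003.localLayerPointsOfEmb κ (closureEmb (K := K) E₁) W n := by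
  set J : localPoints W E₁ →+ localPoints W E₂ :=
    (show localPoints W E₁ →+ localPoints W E₂ from
      Affine.Point.map (W' := W) ((absClosureEmbedding E₁ E₂).restrictScalars K)) with hJ
  have hJs : ∀ (σ : absoluteGaloisGroup E₂) (R : localPoints W E₁),
      J (absGaloisRestrict E₁ E₂ σ • R) = σ • J R := fun σ R => by
    rw [localPoints.smul_def W E₂ σ (J R)]
    exact LocalModelTransport.map_smul_localPoints W E₁ E₂ σ R
  have hJinj : Function.Injective J :=
    Affine.Point.map_injective (W' := W) ((absClosureEmbedding E₁ E₂).restrictScalars K)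
  rw [Kobayashi2003.mem_localLayerPointsOfEmb_iff, Kobayashi2003.mem_localLayerPointsOfEmb_iff]
  constructor
  · intro h σ₁ hσ₁
    obtain ⟨σ₂, hσ₂, rfl⟩ :=
      exists_absGaloisRestrict_eq_of_mem_localLayerSubgroupOfEmb κ E₁ E₂ hs hτ n hσ₁
    apply hJinj
    rw [hJs]
    exact h σ₂ hσ₂
  · intro h σ₂ hσ₂
    rw [← hJs, h _ ((mem_localLayerSubgroupOfEmb_iff_absGaloisRestrict_mem κ E₁ E₂ hτ n σ₂).mp hσ₂)]

/-- **The local traces correspond: `Tr^{E₂}_{n/m}(J Q) = J(Tr^{E₁}_{n/m} Q)` for `Q ∈ E(K_n·E₁)`**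
(isomorphic models). `r` induces a bijection of the coset spaces
`Gal(Ē₂/K_m E₂)/Gal(Ē₂/K_n E₂) ≃ Gal(Ē₁/K_m E₁)/Gal(Ē₁/K_n E₁)` (the layer subgroups are the
`r`-preimages of each other and `r` is onto), the trace of a layer point is the sum over ANY system
of coset representatives (`localTraceOfEmb_apply_eq_sum_of_mem`), and `J(r σ • Q) = σ • J Q`.
[cite: Kobayashi2003, Def. 1.1 (p. 2) (the trace maps Tr_{n/m})] [cite: SerreGaloisCohomology1997, II.§1.1] -/
theorem map_localTraceOfEmb_eq [IsScalarTower K E₁ E₂] [Algebra.IsAlgebraic E₁ E₂]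
    (hs : Function.Surjective (algebraMap E₁ E₂)) {τ : absoluteGaloisGroup K}
    (hτ : ∀ x : AlgebraicClosure K,
      absClosureEmbedding K E₂ (τ • x) = absClosureEmbedding E₁ E₂ (absClosureEmbedding K E₁ x))
    (m n : ℕ) {Q : localPoints W E₁}
    (hQ : Q ∈ Kobayashi2003.localLayerPointsOfEmb κ (closureEmb (K := K) E₁) W n) :
    Kobayashi2003.localTraceOfEmb κ (closureEmb (K := K) E₂) W m n
        ((show localPoints W E₁ →+ localPoints W E₂ from
          Affine.Point.map (W' := W) ((absClosureEmbedding E₁ E₂).restrictScalars K)) Q) =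
      (show localPoints W E₁ →+ localPoints W E₂ from
          Affine.Point.map (W' := W) ((absClosureEmbedding E₁ E₂).restrictScalars K))
        (Kobayashi2003.localTraceOfEmb κ (closureEmb (K := K) E₁) W m n Q) := by
  set J : localPoints W E₁ →+ localPoints W E₂ :=
    (show localPoints W E₁ →+ localPoints W E₂ from
      Affine.Point.map (W' := W) ((absClosureEmbedding E₁ E₂).restrictScalars K)) with hJ
  have hJs : ∀ (σ : absoluteGaloisGroup E₂) (R : localPoints W E₁),
      J (absGaloisRestrict E₁ E₂ σ • R) = σ • J R := fun σ R => by
    rw [localPoints.smul_def W E₂ σ (J R)]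
    exact LocalModelTransport.map_smul_localPoints W E₁ E₂ σ R
  -- notation for the layer subgroups and the coset spaces
  set L₁m := Kobayashi2003.localLayerSubgroupOfEmb κ (closureEmb (K := K) E₁) m with hL₁m
  set L₁n := Kobayashi2003.localLayerSubgroupOfEmb κ (closureEmb (K := K) E₁) n with hL₁n
  set L₂m := Kobayashi2003.localLayerSubgroupOfEmb κ (closureEmb (K := K) E₂) m with hL₂m
  set L₂n := Kobayashi2003.localLayerSubgroupOfEmb κ (closureEmb (K := K) E₂) n with hL₂n
  set r := absGaloisRestrict E₁ E₂ with hr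
  have hrm : ∀ σ : absoluteGaloisGroup E₂, σ ∈ L₂m ↔ r σ ∈ L₁m :=
    fun σ => mem_localLayerSubgroupOfEmb_iff_absGaloisRestrict_mem κ E₁ E₂ hτ m σ
  have hrn : ∀ σ : absoluteGaloisGroup E₂, σ ∈ L₂n ↔ r σ ∈ L₁n :=
    fun σ => mem_localLayerSubgroupOfEmb_iff_absGaloisRestrict_mem κ E₁ E₂ hτ n σ
  haveI : Fintype (L₁m ⧸ L₁n.subgroupOf L₁m) := Fintype.ofFinite _
  haveI : Fintype (L₂m ⧸ L₂n.subgroupOf L₂m) := Fintype.ofFinite _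
  -- a system of representatives on the `E₂` side and its image under `r`
  let s₂ : L₂m ⧸ L₂n.subgroupOf L₂m → L₂m := fun q => q.out
  have hs₂ : ∀ q, ((s₂ q : L₂m) : L₂m ⧸ L₂n.subgroupOf L₂m) = q := fun q => q.out_eq
  let ρ : L₂m → L₁m := fun g => ⟨r g, (hrm g).mp g.2⟩
  let φ : L₂m ⧸ L₂n.subgroupOf L₂m → L₁m ⧸ L₁n.subgroupOf L₁m := fun q => (ρ (s₂ q) : L₁m)
  -- `φ` is a bijection
  have hφmk : ∀ g : L₂m, φ (g : L₂m ⧸ L₂n.subgroupOf L₂m) = (ρ g : L₁m ⧸ L₁n.subgroupOf L₁m) := by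
    intro g
    apply QuotientGroup.eq.mpr
    rw [Subgroup.mem_subgroupOf]
    change (r (s₂ g : L₂m))⁻¹ * r g ∈ L₁n
    rw [← map_inv, ← map_mul, ← hrn]
    have h := QuotientGroup.eq.mp (hs₂ (g : L₂m ⧸ L₂n.subgroupOf L₂m))
    rw [Subgroup.mem_subgroupOf, Subgroup.coe_mul, Subgroup.coe_inv] at h
    exact h
  have hφinj : Function.Injective φ := by
    intro a b hab
    rw [← hs₂ a, ← hs₂ b]
    apply QuotientGroup.eq.mpr
    rw [Subgroup.mem_subgroupOf]
    have h := QuotientGroup.eq.mp hab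
    rw [Subgroup.mem_subgroupOf] at h
    change (r (s₂ a : L₂m))⁻¹ * r (s₂ b) ∈ L₁n at h
    rw [← map_inv, ← map_mul, ← hrn] at h
    simpa using h
  have hφsurj : Function.Surjective φ := by
    intro q
    induction q using QuotientGroup.induction_on with
    | H g =>
      obtain ⟨σ₂, hσ₂, hσ⟩ :=
        exists_absGaloisRestrict_eq_of_mem_localLayerSubgroupOfEmb κ E₁ E₂ hs hτ m g.2
      refine ⟨((⟨σ₂, hσ₂⟩ : L₂m) : L₂m ⧸ L₂n.subgroupOf L₂m), ?_⟩
      rw [hφmk]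
      congr 1
      exact Subtype.ext hσ
  let e : (L₂m ⧸ L₂n.subgroupOf L₂m) ≃ (L₁m ⧸ L₁n.subgroupOf L₁m) := Equiv.ofBijective φ ⟨hφinj, hφsurj⟩
  -- the transported system of representatives on the `E₁` side
  let s₁ : L₁m ⧸ L₁n.subgroupOf L₁m → L₁m := fun q => ρ (s₂ (e.symm q))
  have hs₁ : ∀ q, ((s₁ q : L₁m) : L₁m ⧸ L₁n.subgroupOf L₁m) = q := fun q => by
    change φ (e.symm q) = q
    exact e.apply_symm_apply q
  -- compute both traces as sums over representatives
  have hJQ : J Q ∈ Kobayashi2003.localLayerPointsOfEmb κ (closureEmb (K := K) E₂) W n :=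
    (map_mem_localLayerPointsOfEmb_iff W κ E₁ E₂ hs hτ n Q).mpr hQ
  rw [Kobayashi2003.localTraceOfEmb_apply_eq_sum_of_mem κ (closureEmb (K := K) E₂) W m n hJQ s₂ hs₂,
    Kobayashi2003.localTraceOfEmb_apply_eq_sum_of_mem κ (closureEmb (K := K) E₁) W m n hQ s₁ hs₁,
    map_sum, ← e.sum_comp]
  refine Finset.sum_congr rfl fun q _ => ?_
  rw [← hJs]
  change J (r (s₂ q : L₂m) • Q) = J (r (s₂ (e.symm (e q)) : L₂m) • Q)
  rw [e.symm_apply_apply]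

/-- **Kobayashi's signed local points correspond: `J Q ∈ E^ε(K_n·E₂) ↔ Q ∈ E^ε(K_n·E₁)`**
(isomorphic models; Def. 1.1: layer points whose traces `Tr_{n/m+1}` land in the layer-`m` points
for the `m` of sign `ε`). [cite: Kobayashi2003, Def. 1.1 (p. 2)] -/
theorem map_mem_signedLocalPointsOfEmb_iff [IsScalarTower K E₁ E₂] [Algebra.IsAlgebraic E₁ E₂]
    (hs : Function.Surjective (algebraMap E₁ E₂)) {τ : absoluteGaloisGroup K}
    (hτ : ∀ x : AlgebraicClosure K,
      absClosureEmbedding K E₂ (τ • x) = absClosureEmbedding E₁ E₂ (absClosureEmbedding K E₁ x))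
    (ε : ℤˣ) (n : ℕ) (Q : localPoints W E₁) :
    (show localPoints W E₁ →+ localPoints W E₂ from
        Affine.Point.map (W' := W) ((absClosureEmbedding E₁ E₂).restrictScalars K)) Q ∈
        Kobayashi2003.signedLocalPointsOfEmb κ (closureEmb (K := K) E₂) W ε n ↔
      Q ∈ Kobayashi2003.signedLocalPointsOfEmb κ (closureEmb (K := K) E₁) W ε n := by
  rw [Kobayashi2003.mem_signedLocalPointsOfEmb_iff, Kobayashi2003.mem_signedLocalPointsOfEmb_iff,
    map_mem_localLayerPointsOfEmb_iff W κ E₁ E₂ hs hτ n Q]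
  refine and_congr_right fun hQ => forall_congr' fun m => forall_congr' fun _ =>
    forall_congr' fun _ => ?_
  rw [map_localTraceOfEmb_eq W κ E₁ E₂ hs hτ (m + 1) n hQ,
    map_mem_localLayerPointsOfEmb_iff W κ E₁ E₂ hs hτ m]


/-! ## §2 The Kummer condition moves by `conj_τ` -/

omit [Fact p.Prime] in
/-- **The Kummer condition moves by the comparison element**: if `c ∈ H¹(H, E[p^∞])` satisfies
Kobayashi's Kummer condition at the model `E₁` for `A ≤ E(Ē₁)` (`c = [φ]`, `ι_{E₁}(φ(t|_{K̄})) = tQ − Q`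
on `Gal(Ē₁/L_w)`, `pᵏQ ∈ A`), then `conj_τ c` satisfies it at `E₂` for `J(A)`: take the conjugated
cocycle `(τ·φ)(h) = τ φ(τ⁻¹ h τ)` (`conjH1_oneCocycleClass`) and the point `J Q`; for `t ∈ Gal(Ē₂/L_{w'})`,
`τ⁻¹ t|_{K̄} τ = (r t)|_{K̄}` and `ι_{E₂}(τ • P) = J(ι_{E₁} P)`, so
`ι_{E₂}((τ·φ)(t|)) = J(ι_{E₁} φ((r t)|)) = J(r t • Q − Q) = t • JQ − JQ`.
[cite: Kobayashi2003, Def. 1.1 (p. 2) and §2 p. 4 (the Kummer map)] [cite: SerreGaloisCohomology1997, I.§2.5, II.§1.1] -/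
theorem conjH1_mem_localKummerOverOfEmb_map [IsScalarTower K E₁ E₂]
    (H : Subgroup (absoluteGaloisGroup K)) [H.Normal] {τ : absoluteGaloisGroup K}
    (hτ : ∀ x : AlgebraicClosure K,
      absClosureEmbedding K E₂ (τ • x) = absClosureEmbedding E₁ E₂ (absClosureEmbedding K E₁ x))
    (A : AddSubgroup (localPoints W E₁)) {c : W.subgroupH1 p H}
    (hc : c ∈ Kobayashi2003.localKummerOverOfEmb W p H (closureEmb (K := K) E₁) A) :
    W.conjH1 p H τ c ∈ Kobayashi2003.localKummerOverOfEmb W p H (closureEmb (K := K) E₂)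
      (A.map (show localPoints W E₁ →+ localPoints W E₂ from
        Affine.Point.map (W' := W) ((absClosureEmbedding E₁ E₂).restrictScalars K))) := by
  set J : localPoints W E₁ →+ localPoints W E₂ :=
    (show localPoints W E₁ →+ localPoints W E₂ from
      Affine.Point.map (W' := W) ((absClosureEmbedding E₁ E₂).restrictScalars K)) with hJ
  have hJs : ∀ (σ : absoluteGaloisGroup E₂) (R : localPoints W E₁),
      J (absGaloisRestrict E₁ E₂ σ • R) = σ • J R := fun σ R => by
    rw [localPoints.smul_def W E₂ σ (J R)]
    exact LocalModelTransport.map_smul_localPoints W E₁ E₂ σ R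
  have hJι : ∀ P : geomPoints W,
      pointsMapOfEmb W (closureEmb (K := K) E₂) (τ • P) = J (pointsMapOfEmb W (closureEmb (K := K) E₁) P) :=
    fun P => LocalModelTransport.pointsMap_smul_eq_map_pointsMap W E₁ E₂ hτ P
  have hconj := LocalModelTransport.absGaloisRestrict_absGaloisRestrict_eq_conj K E₁ E₂ hτ
  obtain ⟨φ, Q, k, rfl, hA, hloc⟩ := hc
  refine ⟨conjCocycle H τ φ, J Q, k, ?_, ?_, fun t => ?_⟩
  · exact (conjH1_oneCocycleClass H τ φ).symm
  · rw [← map_nsmul]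
    exact AddSubgroup.mem_map_of_mem J hA
  · -- `r t` lies in the local subgroup at `E₁`
    have ht₁ : absGaloisRestrict E₁ E₂ (t : absoluteGaloisGroup E₂) ∈
        localSubgroupOfEmb H (closureEmb (K := K) E₁) := by
      rw [mem_localSubgroupOfEmb_iff, ← resGal_eq]
      change absGaloisRestrict K E₁ (absGaloisRestrict E₁ E₂ t) ∈ H
      rw [hconj]
      have hn : absGaloisRestrict K E₂ (t : absoluteGaloisGroup E₂) ∈ H := by
        have h2 := t.2
        rw [mem_localSubgroupOfEmb_iff, ← resGal_eq] at h2
        exact h2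
      have h3 := ‹H.Normal›.conj_mem _ hn τ⁻¹
      rwa [inv_inv] at h3
    have key := hloc ⟨_, ht₁⟩
    have hsub : subgroupConj H τ (resGalSubgroupOfEmb H (closureEmb (K := K) E₂) t) =
        resGalSubgroupOfEmb H (closureEmb (K := K) E₁) ⟨_, ht₁⟩ := by
      apply Subtype.ext
      rw [subgroupConj_apply_coe]
      change τ⁻¹ * resGalOfEmb (closureEmb (K := K) E₂) t * τ =
        resGalOfEmb (closureEmb (K := K) E₁) (absGaloisRestrict E₁ E₂ t)
      rw [← resGal_eq, ← resGal_eq]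
      exact (hconj t).symm
    rw [conjCocycle_apply, hsub, primaryComponent.coe_smul, hJι, key, map_sub, hJs]


end Summit.BirchSwinnertonDyer.BirchSwinnertonDyer.Theorems

end
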